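import Mathlib
import Summits.ValiantsHypothesis.ValiantsHypothesis.Theorems.NewtonUnitEquationsTwoProductsRadixResidueOn

/-!
# Radix residue on a coset: the coset Mahler coefficient identity

For a multiscale product `F * expand M C` (where `MvPolynomial.expand M` substitutes
`x ↦ x^M`, `y ↦ y^M`) and a base point `s`, let `ψ` collect the coefficients of `F` on the
coset `s + M • ℕ²`, i.e. `coeff c ψ = coeff (s + M • c) F`. If every exponent of `F` that is
congruent to `s` coordinatewise modulo `M` dominates `s` coordinatewise, then the coefficients
of `F * expand M C` on the coset `s + M • ℕ²` are those of the smaller instance `ψ * C`: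
`coeff (s + M • p) (F * expand M C) = coeff p (ψ * C)`.

The proof writes `C` as a sum of monomials (`MvPolynomial.as_sum`), pushes `expand M` and the
products through the sums, and compares termwise in the exponent `b` of `C` via
`MvPolynomial.coeff_mul_monomial'`:
* if `b ≤ p`, both sides read the coefficient of `F` at `s + M • (p - b)`;
* if `¬ b ≤ p` but `M • b ≤ s + M • p`, the exponent `s + M • p - M • b` is congruent to `s`
  modulo `M`, so if it carried a nonzero coefficient of `F` the domination hypothesis would
  force `b ≤ p`; hence both sides vanish;
* if `¬ M • b ≤ s + M • p`, then also `¬ b ≤ p` and both sides vanish.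
-/

set_option linter.dupNamespace false

namespace Summit.ValiantsHypothesis.ValiantsHypothesis.Theorems.TwoProducts.RadixCosetOn

open Summit.ValiantsHypothesis.ValiantsHypothesis.Theorems.TwoProducts.RadixResidueOn

/-- Shifted compatibility of scaling with truncated subtraction: if `b ≤ p` coordinatewise,
then `s + M • p - M • b = s + M • (p - b)` (the subtraction on the left is genuine). -/
theorem add_smul_tsub_smul_of_le (M : ℕ) (s : Fin 2 →₀ ℕ) {b p : Fin 2 →₀ ℕ} (h : b ≤ p) :
    s + M • p - M • b = s + M • (p - b) := by
  ext i
  have hi : M * b i ≤ M * p i := Nat.mul_le_mul_left M (h i)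
  simp only [Finsupp.tsub_apply, Finsupp.add_apply, Finsupp.smul_apply, smul_eq_mul]
  rw [mul_tsub]
  omega

/-- Residues along the coset: if `M • b ≤ s + M • p` coordinatewise, then every coordinate of
`s + M • p - M • b` is congruent to the corresponding coordinate of `s` modulo `M`. -/
theorem add_smul_tsub_smul_mod {M : ℕ} {s b p : Fin 2 →₀ ℕ} (h : M • b ≤ s + M • p)
    (i : Fin 2) : (s + M • p - M • b) i % M = s i % M := by
  have hi := h i
  simp only [Finsupp.tsub_apply, Finsupp.add_apply, Finsupp.smul_apply, smul_eq_mul] at hi ⊢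
  calc (s i + M * p i - M * b i) % M
      = (s i + M * p i - M * b i + M * b i) % M := (Nat.add_mul_mod_self_left _ _ _).symm
    _ = (s i + M * p i) % M := by rw [Nat.sub_add_cancel hi]
    _ = s i % M := Nat.add_mul_mod_self_left _ _ _

/-- The key order-theoretic step: if `M ≥ 1`, `M • b ≤ s + M • p` and `s ≤ s + M • p - M • b`
coordinatewise, then `b ≤ p`. -/
theorem le_of_le_add_smul_tsub_smul {M : ℕ} (hM : 1 ≤ M) {s b p : Fin 2 →₀ ℕ}
    (h : M • b ≤ s + M • p) (hs : s ≤ s + M • p - M • b) : b ≤ p := by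
  refine (smul_le_smul_iff_of_one_le hM b p).mp (Finsupp.le_def.mpr fun i => ?_)
  have hi := h i
  have hsi := hs i
  simp only [Finsupp.tsub_apply, Finsupp.add_apply, Finsupp.smul_apply, smul_eq_mul] at hi hsi ⊢
  omega

/-- **Coset Mahler coefficient identity** (radix residue on a coset). Let `M ≥ 1`, let `ψ`
collect the coefficients of `F` on the coset `s + M • ℕ²` (`coeff c ψ = coeff (s + M • c) F`),
and assume every exponent `d` in the support of `F` with `d ≡ s` coordinatewise modulo `M`
satisfies `s ≤ d`. Then for every `p`, the coefficient of `F * expand M C` at `s + M • p`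
equals the coefficient of `ψ * C` at `p`. -/
theorem stub_radixCosetOn : ∀ (M : ℕ) (F ψ C : MvPolynomial (Fin 2) ℂ) (s : Fin 2 →₀ ℕ), 1 ≤ M →
    (∀ c : Fin 2 →₀ ℕ, MvPolynomial.coeff c ψ = MvPolynomial.coeff (s + M • c) F) →
    (∀ d ∈ F.support, d 0 % M = s 0 % M → d 1 % M = s 1 % M → s ≤ d) →
    ∀ p : Fin 2 →₀ ℕ, MvPolynomial.coeff (s + M • p) (F * MvPolynomial.expand M C) =
      MvPolynomial.coeff p (ψ * C) := by
  intro M F ψ C s hM hψ hdom p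
  conv_lhs => rw [C.as_sum]
  conv_rhs => rw [C.as_sum]
  rw [map_sum, Finset.mul_sum, Finset.mul_sum, MvPolynomial.coeff_sum, MvPolynomial.coeff_sum]
  refine Finset.sum_congr rfl fun b _ => ?_
  rw [MvPolynomial.expand_monomial, MvPolynomial.coeff_mul_monomial',
    MvPolynomial.coeff_mul_monomial']
  by_cases hb : b ≤ p
  · have h1 : M • b ≤ s + M • p :=
      le_add_of_le_right ((smul_le_smul_iff_of_one_le hM b p).mpr hb)
    rw [if_pos h1, if_pos hb, add_smul_tsub_smul_of_le M s hb, hψ]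
  · rw [if_neg hb]
    by_cases h2 : M • b ≤ s + M • p
    · rw [if_pos h2]
      suffices h0 : MvPolynomial.coeff (s + M • p - M • b) F = 0 by rw [h0, zero_mul]
      by_contra hne
      have hmem : s + M • p - M • b ∈ F.support := MvPolynomial.mem_support_iff.mpr hne
      have hsd : s ≤ s + M • p - M • b :=
        hdom _ hmem (add_smul_tsub_smul_mod h2 0) (add_smul_tsub_smul_mod h2 1)
      exact hb (le_of_le_add_smul_tsub_smul hM h2 hsd)
    · rw [if_neg h2]

end Summit.ValiantsHypothesis.ValiantsHypothesis.Theorems.TwoProducts.RadixCosetOn
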